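import Literature.NumberTheory.Automorphic.ShimuraCurveRibetTakahashiBrandtDictionaryProofs
import Literature.NumberTheory.Automorphic.ShimuraCurveTakahashiCoordinateInputs
import Literature.NumberTheory.Automorphic.ShimuraParametrizationSplitDegreeProofs
import Literature.NumberTheory.Automorphic.ShimuraCurveDataExistence
import Literature.NumberTheory.Automorphic.ShimuraCurveRibetTakahashiSemistableManinProofs
import Literature.NumberTheory.EllipticCurves.TakahashiDegreeFormula
import Literature.NumberTheory.EllipticCurves.TakahashiDegreeFormulaFromDictionary
import Literature.NumberTheory.EllipticCurves.CuspFormLFunctionLevelConductorProofs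
import Literature.NumberTheory.EllipticCurves.IsogenyIdProofs
import Literature.NumberTheory.EllipticCurves.IsogenyConductorModularityProofs
import Summits.ABC.ABC.Theorems.DefiniteXiFreyModularity
import Summits.ABC.ABC.Theorems.DefiniteXiDefiniteRTControlPrime
import HarnessLib

/-!
# stub_takahashi (crux `DefiniteXi.DefiniteRTControlPrime`, stmt-ABC-11338) — gen-5 k1 companion
# (FAMILY 1, recognise & import, one level deeper than gens 3/4): the BSD twin
# `takahashi2001_thm_2_3_shimura_level` is ITSELF a TREE THEOREM over ONE printed input — the
# LEVEL-SIDE character-group dictionary `hDict` of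
# `Literature/NumberTheory/Automorphic/ShimuraCurveRibetTakahashiBrandtDictionaryProofs.lean` §II
# (`thm_2_3_level_of_brandtDictionary`, BSD cell, Aug 16).  That hypothesis is rendered here as
# ONE Prop `CharGroupDictionaryLevel` (= `hDict` VERBATIM) — the candidate named fact
# `shimuraCurve_characterGroupHeckeDictionary_level`, the level-side sibling of the typed
# discriminant-side fact `shimuraCurve_characterGroupHeckeDictionary_disc` — with its two halves
# `CharGroupDictionaryLevelNoRank` / `BrandtRankOneLevel` (the disc fact also omits multiplicity
# one; the tree's square-free `D = 1` pair `takahashi2001_characterGroupDictionary` /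
# `takahashi2001_brandtEigenLattice_rank_one` is the same cut), and the compositions BY NAME:
#   D1 ⟹ twin (A1) ⟹ stub given level = conductor (A3; modularity / Carayol dischargers)
#      ⟹ crux `DefiniteRTControlPrime` (A4, through the landed `definiteRTControlPrime_of_facts`).
# The modularity-free composition D1 ⟹ crux (constant `4·163²`) is gen-4's
# `StubIdeas1G4.definiteRTControlPrime_of_twin ∘ A1` (Cruxes modules are not importable on the
# farm snapshot, so it is recorded by name in the STUB-IDEAS file, not re-elaborated here).

The `LevelIsConductor` block is reproduced from k1-g3 (`StubIdeas1G3TakahashiSketch.lean`, rc 0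
there) for the same reason.  Nothing here is a new named fact of the tree; the defs are candidate
SIGNATURES for the typer.  No `sorry`.
-/

noncomputable section

open scoped BigOperators

namespace Summit.ABC.ABC.Cruxes.DefiniteRTControlPrime.StubIdeas1G5

open Literature.NumberTheory.Automorphic Literature.NumberTheory.EllipticCurves
open Literature.NumberTheory.EllipticCurves.ModularForms
open Summit.ABC.ABC.Theses.DefiniteXi

/-! ## D1 — the level-side character-group dictionary (Shimura idiom, general `D`, any cofactor) -/

/-- **D1 (named-fact candidate `shimuraCurve_characterGroupHeckeDictionary_level`; VERBATIM the
hypothesis `hDict` of `ShimuraCurveRibetTakahashiBrandtDictionaryProofs` §II).** For `N = DM`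
admissible, `M = p m`, `p ∤ m`, `W/ℚ` of conductor `N`, `P` a class-minimal Shimura datum of `W` on
`X : ShimuraCurveData D M` (carrier `W' ≅ A_{D,M}`, `P.deg = δ_{D,M}`) and EVERY Brandt setup `S` of
type `(m, Dp)`: a sublattice `Y ⊆ ℤ^{Cls O}` (`X_p(J₀^D(M)) ≅ ℤ[Cls O]⁰`), `pb = q^*`, `pf = q_*`
with (adj) Grothendieck adjunction for `c_p = ord_p Δ_min(W')`, (δ) `q_* q^* = P.deg`, (opt) `q_*`
onto, (sat) `Y` saturated, (deg⁰) `ℤ[Cls O]⁰ ⊆ Y`, (rk1) the `a(W')`-eigen-lattice has rank one,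
(eig) `q^* 1` lies in it.  Sources at the page: Takahashi 2001 §2 p. 78 + p. 84; Buzzard 1997
Thm. 4.7 (v); `D = 1`: Ribet 1990 Prop. 3.1 / Thm. 3.10, Kohel 2001 Thm. 4.3, Conrad–Stein 2001
§7.1 (arbitrary cofactor); SGA 7 IX 11.5; (rk1) Jacquet–Langlands + multiplicity one, `D = 1`:
Pizer 1980 Thm. 2.28 (tree: `finrank_eigenLattice_eq_one_of_eichlerPizerIso`). -/
def CharGroupDictionaryLevel : Prop :=
  ∀ {N D M p m : ℕ}, p.Prime → M = p * m → ¬ p ∣ m → IsAdmissibleFactorization N D M →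
    ∀ (X : ShimuraCurveData D M) (W : WeierstrassCurve ℚ) [W.IsElliptic], W.conductorNorm ℤ = N →
    ∀ (W' : WeierstrassCurve ℚ) [W'.IsElliptic] (P : ShimuraParametrizationData X W'),
      P.IsMinimalFor W →
    ∀ (S : Brandt.XiSetup m (D * p)) [Fintype (Brandt.ClassSet S.O)],
      ∃ (Y : Submodule ℤ (Brandt.ClassSet S.O → ℤ)) (pb : ℤ →ₗ[ℤ] Y) (pf : Y →ₗ[ℤ] ℤ),
        (∀ (a : ℤ) (y : Y),
            ∑ i, (Brandt.weight S.O i : ℤ) * (pb a : Brandt.ClassSet S.O → ℤ) i *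
                (y : Brandt.ClassSet S.O → ℤ) i =
              ((W'.minimalDiscriminantNorm ℤ).factorization p : ℤ) * a * pf y) ∧
        (∀ a : ℤ, pf (pb a) = (P.deg : ℤ) * a) ∧
        Function.Surjective pf ∧
        (∀ (k : ℤ) (v : Brandt.ClassSet S.O → ℤ), k ≠ 0 → k • v ∈ Y → v ∈ Y) ∧
        (∀ v : Brandt.ClassSet S.O → ℤ, ∑ i, v i = 0 → v ∈ Y) ∧
        Module.finrank ℤ
            (Brandt.eigenLattice (m * (D * p)) (Brandt.matrix S.O) (fun n => W'.LFunction n)) = 1 ∧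
        (pb 1 : Brandt.ClassSet S.O → ℤ) ∈
          Brandt.eigenLattice (m * (D * p)) (Brandt.matrix S.O) (fun n => W'.LFunction n)

/-- **D1♭: D1 WITHOUT the rank-one conjunct** — the exact level-side mirror of the typed
discriminant-side fact `shimuraCurve_characterGroupHeckeDictionary_disc` (which also omits
multiplicity one): pure arithmetic geometry of `J₀^D(M)` at `p ∥ M`. -/
def CharGroupDictionaryLevelNoRank : Prop :=
  ∀ {N D M p m : ℕ}, p.Prime → M = p * m → ¬ p ∣ m → IsAdmissibleFactorization N D M →
    ∀ (X : ShimuraCurveData D M) (W : WeierstrassCurve ℚ) [W.IsElliptic], W.conductorNorm ℤ = N →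
    ∀ (W' : WeierstrassCurve ℚ) [W'.IsElliptic] (P : ShimuraParametrizationData X W'),
      P.IsMinimalFor W →
    ∀ (S : Brandt.XiSetup m (D * p)) [Fintype (Brandt.ClassSet S.O)],
      ∃ (Y : Submodule ℤ (Brandt.ClassSet S.O → ℤ)) (pb : ℤ →ₗ[ℤ] Y) (pf : Y →ₗ[ℤ] ℤ),
        (∀ (a : ℤ) (y : Y),
            ∑ i, (Brandt.weight S.O i : ℤ) * (pb a : Brandt.ClassSet S.O → ℤ) i *
                (y : Brandt.ClassSet S.O → ℤ) i =
              ((W'.minimalDiscriminantNorm ℤ).factorization p : ℤ) * a * pf y) ∧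
        (∀ a : ℤ, pf (pb a) = (P.deg : ℤ) * a) ∧
        Function.Surjective pf ∧
        (∀ (k : ℤ) (v : Brandt.ClassSet S.O → ℤ), k ≠ 0 → k • v ∈ Y → v ∈ Y) ∧
        (∀ v : Brandt.ClassSet S.O → ℤ, ∑ i, v i = 0 → v ∈ Y) ∧
        (pb 1 : Brandt.ClassSet S.O → ℤ) ∈
          Brandt.eigenLattice (m * (D * p)) (Brandt.matrix S.O) (fun n => W'.LFunction n)

/-- **D2: multiplicity one on the definite quaternion side, level side, Shimura idiom** ("`L_p(J)`
is free of rank one", Takahashi p. 78; Jacquet–Langlands + strong multiplicity one), for the carrier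
`W'` of a class-minimal datum on `X₀^D(M)`.  At `D = 1` the tree's Eichler–Pizer chain
(`traceIdentity_of_traceFormulas` → `nonempty_eichlerPizerIso_of_traceIdentity` →
`finrank_eigenLattice_eq_one_of_eichlerPizerIso`) proves the analogous classical statement modulo
GL₂/Brandt trace formulas (square-free cofactor for `XiSetup.ellipticTerm_eq`). -/
def BrandtRankOneLevel : Prop :=
  ∀ {N D M p m : ℕ}, p.Prime → M = p * m → ¬ p ∣ m → IsAdmissibleFactorization N D M →
    ∀ (X : ShimuraCurveData D M) (W : WeierstrassCurve ℚ) [W.IsElliptic], W.conductorNorm ℤ = N →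
    ∀ (W' : WeierstrassCurve ℚ) [W'.IsElliptic] (P : ShimuraParametrizationData X W'),
      P.IsMinimalFor W →
    ∀ (S : Brandt.XiSetup m (D * p)) [Fintype (Brandt.ClassSet S.O)],
      Module.finrank ℤ
          (Brandt.eigenLattice (m * (D * p)) (Brandt.matrix S.O) (fun n => W'.LFunction n)) = 1

/-- **A0 (PROVED): D1 ⇐ D1♭ ∧ D2.** -/
theorem charGroupDictionaryLevel_of_noRank_of_rankOne (h₁ : CharGroupDictionaryLevelNoRank)
    (h₂ : BrandtRankOneLevel) : CharGroupDictionaryLevel := by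
  intro N D M p m hp hM hpm hadm X W _ hWN W' _ P hP S _
  obtain ⟨Y, pb, pf, hadj, hδ, hsurj, hsat, h0, hmem⟩ := h₁ hp hM hpm hadm X W hWN W' P hP S
  exact ⟨Y, pb, pf, hadj, hδ, hsurj, hsat, h0, h₂ hp hM hpm hadm X W hWN W' P hP S, hmem⟩

/-- **A0′ (PROVED): D1 ⇒ D1♭.** -/
theorem noRank_of_charGroupDictionaryLevel (h : CharGroupDictionaryLevel) :
    CharGroupDictionaryLevelNoRank := by
  intro N D M p m hp hM hpm hadm X W _ hWN W' _ P hP S _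
  obtain ⟨Y, pb, pf, hadj, hδ, hsurj, hsat, h0, -, hmem⟩ := h hp hM hpm hadm X W hWN W' P hP S
  exact ⟨Y, pb, pf, hadj, hδ, hsurj, hsat, h0, hmem⟩

/-- **A0″ (PROVED): D1 ⇒ D2.** -/
theorem rankOne_of_charGroupDictionaryLevel (h : CharGroupDictionaryLevel) : BrandtRankOneLevel := by
  intro N D M p m hp hM hpm hadm X W _ hWN W' _ P hP S _
  obtain ⟨-, -, -, -, -, -, -, -, hrank, -⟩ := h hp hM hpm hadm X W hWN W' P hP S
  exact hrank

/-! ## A1 — the import: the BSD twin is a THEOREM over D1 -/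

/-- **A1 (PROVED): `CharGroupDictionaryLevel → takahashi2001_thm_2_3_shimura_level`** — the tree
theorem `Automorphic.thm_2_3_level_of_brandtDictionary` (BSD cell, proof file §II: Takahashi's
`(i_p, j_p)` from the Brandt data via `exists_image_coker_eisenstein_of_brandtData_general`), the
`Fintype` instance of D1 supplied by the theorem itself. -/
theorem twin_of_charGroupDictionaryLevel (h : CharGroupDictionaryLevel) :
    takahashi2001_thm_2_3_shimura_level := by
  intro N D M p m hp hM hpm hadm X W _ hWN W' _ P hP S
  exact thm_2_3_level_of_brandtDictionary (fun hp hM hpm hadm X W _ hWN W' _ P hP S _ =>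
    h hp hM hpm hadm X W hWN W' P hP S) hp hM hpm hadm X W hWN W' P hP S

/-- **A1♭ (PROVED): the twin from the two halves.** -/
theorem twin_of_noRank_of_rankOne (h₁ : CharGroupDictionaryLevelNoRank) (h₂ : BrandtRankOneLevel) :
    takahashi2001_thm_2_3_shimura_level :=
  twin_of_charGroupDictionaryLevel (charGroupDictionaryLevel_of_noRank_of_rankOne h₁ h₂)

/-! ## A2/A3 — the stub AS TYPED from D1 and the level = conductor seam (k1-g3's bridge, reproduced) -/

/-- (g3) "a curve carrying a classical datum at level `N` has conductor `N`" (Carayol restricted to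
the curves that occur). -/
def LevelIsConductor (N : ℕ) [NeZero N] : Prop :=
  ∀ (W : WeierstrassCurve ℚ) [W.IsElliptic] (_D : ModularParametrizationData W N), N = W.conductorNorm ℤ

/-- (g3) unconditional at square-free level. -/
theorem levelIsConductor_of_squarefree {N : ℕ} [NeZero N] (hN : Squarefree N) : LevelIsConductor N :=
  fun _W _ D => D.isNewformOf.level_eq_conductorNorm_of_squarefree_level hN

/-- (g3) from Carayol's named fact `IsNewformOf.level_eq_conductorNorm`. -/
theorem levelIsConductor_of_carayol {N : ℕ} [NeZero N]
    (h : IsNewformOf.level_eq_conductorNorm (N := N)) : LevelIsConductor N :=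
  fun _W _ D => h D.isNewformOf

/-- (g3) from modularity in the data form `nonempty_modularParametrizationData` (route item
FreyModularity's source fact). -/
theorem levelIsConductor_of_modularity (hmod : nonempty_modularParametrizationData) {N : ℕ} [NeZero N] :
    LevelIsConductor N := by
  intro W _ D
  obtain ⟨C, hC⟩ := WeierstrassCurve.hasGlobalMinimalModel_rat_holds W
  haveI := hC
  haveI : NeZero ((C • W).conductorNorm ℤ) := ⟨((C • W).conductorNorm_pos_holds).ne'⟩
  obtain ⟨D'⟩ := hmod (C • W)
  obtain ⟨D₁⟩ := (Summit.ABC.ABC.Theorems.nonempty_modularParametrizationData_smul_iff C).mpr ⟨D⟩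
  rw [D₁.isNewformOf.level_eq_level D'.isNewformOf, WeierstrassCurve.conductorNorm_smul_rat]

/-- (g3) conductor-restricted minimality ⇒ class minimality, given `LevelIsConductor`. -/
theorem classMinimal_of_conductorMinimal {N : ℕ} [NeZero N] (hLC : LevelIsConductor N)
    {W : WeierstrassCurve ℚ} (P : ModularParametrizationData W N)
    (hmin : ∀ (W' : WeierstrassCurve ℚ) [W'.IsElliptic], W'.conductorNorm ℤ = N →
      ∀ P' : ModularParametrizationData W' N, P'.f = P.f → P.modularDegree ≤ P'.modularDegree) :
    ∀ (W₂ : WeierstrassCurve ℚ) [W₂.IsElliptic] (D₂ : ModularParametrizationData W₂ N),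
      D₂.f = P.f → P.modularDegree ≤ D₂.modularDegree :=
  fun W₂ _ D₂ hD₂ => hmin W₂ (hLC W₂ D₂).symm D₂ hD₂

/-- (g3) a Shimura datum on `W` of degree `deg P`, `P` class-minimal, is `IsMinimalFor W`. -/
theorem isMinimalFor_of_classMinimal {N : ℕ} [NeZero N] {X : ShimuraCurveData 1 N}
    {W : WeierstrassCurve ℚ} [W.IsElliptic] (P : ModularParametrizationData W N)
    (hminP : ∀ (W₂ : WeierstrassCurve ℚ) [W₂.IsElliptic] (D₂ : ModularParametrizationData W₂ N),
      D₂.f = P.f → P.modularDegree ≤ D₂.modularDegree)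
    (Q : ShimuraParametrizationData X W) (hQ : Q.deg = P.modularDegree) : Q.IsMinimalFor W :=
  ⟨WeierstrassCurve.isIsogenous_self W, fun W'' _ P'' hiso => by
    rw [hQ]
    exact Nat.le_of_dvd P''.deg_pos (P''.modularDegree_dvd_deg hiso P P.isNewformOf hminP)⟩

/-- **A2 (PROVED): the STUB AS TYPED from D1 and `LevelIsConductor` at every level** — D1 at
`(N, D, M, p, m) = (Mr, 1, Mr, r, M)` for the curve `W` itself and the transported datum. -/
theorem stub_of_charGroupDictionaryLevel (h : CharGroupDictionaryLevel)
    (hLC : ∀ (N : ℕ) [NeZero N], LevelIsConductor N) : takahashi2001_thm_2_3_of_coprime := by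
  have hT : takahashi2001_thm_2_3_shimura_level := twin_of_charGroupDictionaryLevel h
  intro W _ M r _ hr hcop hWN P hPmin S
  have hpos : 0 < M * r := Nat.pos_of_ne_zero (NeZero.ne _)
  have hadm : IsAdmissibleFactorization (M * r) 1 (M * r) := isAdmissibleFactorization_one hpos
  obtain ⟨X⟩ := nonempty_shimuraCurveData_holds hadm
  obtain ⟨Q, hQ⟩ := exists_shimuraParametrizationData_deg_eq_modularDegree X P
  have hminP := classMinimal_of_conductorMinimal (hLC (M * r)) P hPmin
  have hQmin : Q.IsMinimalFor W := isMinimalFor_of_classMinimal P hminP Q hQ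
  have hrM : ¬ r ∣ M := by
    intro hdvd
    have hg : Nat.gcd M r = 1 := hcop
    have h1 : r ∣ Nat.gcd M r := Nat.dvd_gcd hdvd (dvd_refl r)
    rw [hg] at h1
    exact hr.one_lt.ne' (Nat.dvd_one.mp h1)
  have key := hT hr (Nat.mul_comm M r) hrM hadm X W hWN W Q hQmin
  rw [Nat.one_mul] at key
  obtain ⟨i, j, hi, hij, hdvd, hδ⟩ := key S
  exact ⟨i, j, hi, hij, hdvd, by rw [← hQ]; exact hδ⟩

/-- **A3 (PROVED): the stub from D1 and modularity `nonempty_modularParametrizationData`.** -/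
theorem stub_of_charGroupDictionaryLevel_of_modularity (h : CharGroupDictionaryLevel)
    (hmod : nonempty_modularParametrizationData) : takahashi2001_thm_2_3_of_coprime :=
  stub_of_charGroupDictionaryLevel h fun _N _ => levelIsConductor_of_modularity hmod

/-- **A3′ (PROVED): the stub from D1 and Carayol's level theorem.** -/
theorem stub_of_charGroupDictionaryLevel_of_carayol (h : CharGroupDictionaryLevel)
    (hCar : ∀ (N : ℕ) [NeZero N], IsNewformOf.level_eq_conductorNorm (N := N)) :
    takahashi2001_thm_2_3_of_coprime :=
  stub_of_charGroupDictionaryLevel h fun N _ => levelIsConductor_of_carayol (hCar N)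

/-- **A3″ (PROVED): the stub from the two halves D1♭, D2 and modularity.** -/
theorem stub_of_noRank_of_rankOne_of_modularity (h₁ : CharGroupDictionaryLevelNoRank)
    (h₂ : BrandtRankOneLevel) (hmod : nonempty_modularParametrizationData) :
    takahashi2001_thm_2_3_of_coprime :=
  stub_of_charGroupDictionaryLevel_of_modularity (charGroupDictionaryLevel_of_noRank_of_rankOne h₁ h₂)
    hmod

/-! ## A4 — the crux from D1 (+ modularity, 163, Lemma 6.8) through the landed composition -/

/-- **A4 (PROVED): `DefiniteRTControlPrime` from D1, modularity and Pasten's two facts**, through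
the landed `Theorems.DefiniteRTControlPrime.definiteRTControlPrime_of_facts` (p97354; `C = 4·163²`).
Modularity-free variant: `StubIdeas1G4.definiteRTControlPrime_of_twin (twin_of_… h) h163 h68`. -/
theorem definiteRTControlPrime_of_charGroupDictionaryLevel (h : CharGroupDictionaryLevel)
    (hmod : nonempty_modularParametrizationData)
    (h163 : PastenShimura2024_minimalDegree_le_163_mul) (h68 : PastenShimura2024_lemma_6_8) :
    DefiniteRTControlPrime :=
  Summit.ABC.ABC.Theorems.DefiniteRTControlPrime.definiteRTControlPrime_of_facts
    (stub_of_charGroupDictionaryLevel_of_modularity h hmod) h163 h68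

end Summit.ABC.ABC.Cruxes.DefiniteRTControlPrime.StubIdeas1G5

end
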